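import Summits.Ventures.PercRepro.C025ProfileRankFourLemmas

/-!
# The rank-4 certificate: (Cap)(a) — a triangle pays at most 3 (night-3 g8)

NIGHT3-G7-RANK4-CERTIFICATE.md §3(a), in the kernel: a rank-`3` set `S = {x, y, z}` of a simple matroid of rank `4` is
paid by its three pairs only (one extra point each). A pair pays at most `1` unless it is BAD — `j = 2` and
`ρ(E∖S) + 1 = ρ(E∖B)` — when it pays `3/2`. If `B = {x, y}` is bad, the line `cl B` has two points outside `S`, so
`cl B ⊆ H' := cl(E∖S)`; then `{x, z}` has `ρ(E ∖ {x, z}) = ρ((E∖S) ∪ {y}) = ρ(E∖S) =: r` (`y ∈ H'`) and `j({x, z}) = 0`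
(a third point `u` of the line `xz` would lie in `H'`, put `z ∈ cl{x, u} ⊆ H'` and force `ρ(E∖B) = r`), and `r ≤ 3`
(`r + 1 = ρ(E∖B) ≤ 4`), so `{x, z}` (and likewise `{y, z}`) pays at most `r/(r + 1) ≤ 3/4`: the total is at most
`3/2 + 3/4 + 3/4 = 3`.
-/

open scoped Matroid

namespace PercRepro

open Set Finset ThmH

section CapA

variable {α : Type} [DecidableEq α] {M : Matroid α} [M.Finite]

omit [DecidableEq α] [M.Finite] in
/-- In a simple matroid, a point is not in the closure of a different point. -/
theorem notMem_closure_singleton_of_ne (hsimple : ∀ T ⊆ M.E, T.encard ≤ 2 → M.Indep T) {a b : α} (ha : a ∈ M.E)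
    (hb : b ∈ M.E) (hab : a ≠ b) : b ∉ M.closure ({a} : Set α) := by
  have hind : M.Indep ({a} : Set α) :=
    hsimple _ (Set.singleton_subset_iff.2 ha) (by rw [Set.encard_singleton]; exact one_le_two)
  rw [hind.notMem_closure_iff_of_notMem (by rw [Set.mem_singleton_iff]; exact hab.symm) hb]
  apply hsimple
  · exact Set.insert_subset hb (Set.singleton_subset_iff.2 ha)
  · rw [Set.encard_pair hab.symm]

omit [DecidableEq α] [M.Finite] in
/-- Exchange on a pair: if `u ∈ cl {a, b}` and `u ∉ cl {a}` then `b ∈ cl {a, u}`. -/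
theorem mem_closure_pair_exchange {a b u : α} (hu : u ∉ M.closure ({a} : Set α))
    (hub : u ∈ M.closure ({a, b} : Set α)) : b ∈ M.closure ({a, u} : Set α) := by
  rw [Set.pair_comm] at hub
  have h := Matroid.mem_closure_insert hu hub
  rwa [Set.pair_comm]

omit [DecidableEq α] [M.Finite] in
/-- Inserting a point of the closure does not change the rank. -/
theorem eRk_insert_eq_of_mem_closure_set {e : α} {X : Set α} (h : e ∈ M.closure X) : M.eRk (insert e X) = M.eRk X := by
  rw [← M.eRk_insert_closure_eq, Set.insert_eq_of_mem h, M.eRk_closure_eq]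

/-- In a simple matroid two distinct points of the ground set form a rank-`2` finset. -/
theorem eRk_pair_finset_eq_two (hsimple : ∀ T ⊆ M.E, T.encard ≤ 2 → M.Indep T) {x y : α} (hx : x ∈ gr M)
    (hy : y ∈ gr M) (hxy : x ≠ y) : M.eRk ((({x, y} : Finset α) : Finset α) : Set α) = 2 := by
  rw [Finset.coe_pair]
  have hxE : x ∈ M.E := by rw [← coe_gr]; exact_mod_cast hx
  have hyE : y ∈ M.E := by rw [← coe_gr]; exact_mod_cast hy
  exact simple_of_indep_two hsimple x hxE y hyE hxy

/-- **The bad-pair lemma**: if the pair `{x, y}` of the triangle `S = {x, y, z}` is bad (`j = 2` and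
`ρ(E∖S) + 1 = ρ(E ∖ {x,y})`), then the pair `{x, z}` has `ρ(E ∖ {x, z}) = ρ(E∖S)` and `j({x, z}) = 0`. -/
theorem crk_eq_and_jB_eq_zero_of_bad_pair (hsimple : ∀ T ⊆ M.E, T.encard ≤ 2 → M.Indep T) {x y z : α}
    (hxy : x ≠ y) (hxz : x ≠ z) (hyz : y ≠ z) (hxg : x ∈ gr M) (hyg : y ∈ gr M) (hzg : z ∈ gr M)
    (hS : insert z ({x, y} : Finset α) ∈ Shadow.levelSet M 3) (hj : jB M {x, y} = 2)
    (hbad : crk M (insert z ({x, y} : Finset α)) + 1 = crk M {x, y}) :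
    crk M {x, z} = crk M (insert z ({x, y} : Finset α)) ∧ jB M {x, z} = 0 := by
  classical
  set S := insert z ({x, y} : Finset α) with hSdef
  set B := ({x, y} : Finset α) with hBdef
  have hS3 : M.eRk (S : Set α) = 3 := (Profile.mem_levelSet.1 hS).2
  have hBg : B ⊆ gr M := by
    intro w hw
    rw [hBdef, Finset.mem_insert, Finset.mem_singleton] at hw
    rcases hw with rfl | rfl
    · exact hxg
    · exact hyg
  have hB2 : M.eRk (B : Set α) = 2 := eRk_pair_finset_eq_two hsimple hxg hyg hxy
  have hxE : x ∈ M.E := by rw [← coe_gr]; exact_mod_cast hxg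
  have hzE : z ∈ M.E := by rw [← coe_gr]; exact_mod_cast hzg
  -- z is not on the line of B
  have hzL : z ∉ clF M B := by
    intro h
    rw [← Finset.mem_coe, coe_clF] at h
    have : M.eRk (S : Set α) ≤ 2 := by
      calc M.eRk (S : Set α) ≤ M.eRk (M.closure (B : Set α)) := by
            apply M.eRk_mono
            rw [hSdef, Finset.coe_insert]
            exact Set.insert_subset h (M.subset_closure _ (by rw [← coe_gr]; exact_mod_cast hBg))
        _ = 2 := by rw [M.eRk_closure_eq, hB2]
    rw [hS3] at this
    exact absurd this (by decide)
  have hLS : clF M B \ B ⊆ gr M \ S := by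
    intro u hu
    rw [Finset.mem_sdiff] at hu ⊢
    refine ⟨clF_subset_gr B hu.1, ?_⟩
    rw [hSdef, Finset.mem_insert, not_or]
    refine ⟨?_, hu.2⟩
    rintro rfl; exact hzL hu.1
  -- two points of the line outside B, hence outside S
  have hT2 : 2 ≤ (clF M B \ B).card := by
    have hc : (clF M B \ B).card = (clF M B).card - B.card := Finset.card_sdiff_of_subset (subset_clF_self hBg)
    unfold jB at hj
    omega
  obtain ⟨U, hUT, hUc⟩ := Finset.exists_subset_card_eq hT2
  obtain ⟨u₁, u₂, hu12, hU⟩ := Finset.card_eq_two.1 hUc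
  have hu₁ : u₁ ∈ clF M B \ B := hUT (by rw [hU]; exact Finset.mem_insert_self _ _)
  have hu₂ : u₂ ∈ clF M B \ B := hUT (by rw [hU]; exact Finset.mem_insert_of_mem (Finset.mem_singleton_self _))
  have hline : ((clF M B : Finset α) : Set α) ⊆ M.closure ((gr M \ S : Finset α) : Set α) :=
    clF_subset_closure_of_two_mem hsimple hB2 hu12 (Finset.mem_sdiff.1 hu₁).1 (Finset.mem_sdiff.1 hu₂).1
      (by exact_mod_cast hLS hu₁) (by exact_mod_cast hLS hu₂)
  have hxcl : x ∈ M.closure ((gr M \ S : Finset α) : Set α) :=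
    hline (subset_clF_self hBg (by rw [hBdef]; exact Finset.mem_insert_self _ _))
  have hycl : y ∈ M.closure ((gr M \ S : Finset α) : Set α) :=
    hline (subset_clF_self hBg (by rw [hBdef]; exact Finset.mem_insert_of_mem (Finset.mem_singleton_self _)))
  -- the complement of {x, z} is (E ∖ S) ∪ {y}
  have hcompl : gr M \ ({x, z} : Finset α) = insert y (gr M \ S) := by
    ext w
    simp only [Finset.mem_sdiff, Finset.mem_insert, Finset.mem_singleton, hSdef, hBdef, not_or]
    constructor
    · rintro ⟨hw, hwx, hwz⟩
      by_cases hwy : w = y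
      · exact Or.inl hwy
      · exact Or.inr ⟨hw, hwz, hwx, hwy⟩
    · rintro (rfl | ⟨hw, hwz, hwx, hwy⟩)
      · exact ⟨hyg, hxy.symm, hyz⟩
      · exact ⟨hw, hwx, hwz⟩
  constructor
  · -- crk {x, z} = crk S
    have h1 : M.eRk ((gr M \ ({x, z} : Finset α) : Finset α) : Set α) = M.eRk ((gr M \ S : Finset α) : Set α) := by
      rw [hcompl, Finset.coe_insert, eRk_insert_eq_of_mem_closure_set hycl]
    rw [eRk_gr_sdiff_eq_crk, eRk_gr_sdiff_eq_crk] at h1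
    exact_mod_cast h1
  · -- j({x, z}) = 0
    by_contra hne
    have hB'g : ({x, z} : Finset α) ⊆ gr M := by
      intro w hw
      rw [Finset.mem_insert, Finset.mem_singleton] at hw
      rcases hw with rfl | rfl
      · exact hxg
      · exact hzg
    have hT1 : 1 ≤ (clF M {x, z} \ {x, z}).card := by
      have hc : (clF M {x, z} \ {x, z}).card = (clF M {x, z}).card - ({x, z} : Finset α).card :=
        Finset.card_sdiff_of_subset (subset_clF_self hB'g)
      unfold jB at hne
      omega
    obtain ⟨u, hu⟩ := Finset.card_pos.1 hT1
    rw [Finset.mem_sdiff, Finset.mem_insert, Finset.mem_singleton, not_or] at hu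
    obtain ⟨huL, hux, huz⟩ := hu
    have huE : u ∈ M.E := by rw [← coe_gr]; exact_mod_cast clF_subset_gr _ huL
    have hucl : u ∈ M.closure ({x, z} : Set α) := by
      rw [← Finset.mem_coe, coe_clF, Finset.coe_pair] at huL; exact huL
    have hux' : u ∉ M.closure ({x} : Set α) := notMem_closure_singleton_of_ne hsimple hxE huE (Ne.symm hux)
    have hzxu : z ∈ M.closure ({x, u} : Set α) := mem_closure_pair_exchange hux' hucl
    by_cases huy : u = y
    · -- then z ∈ cl {x, y} = cl B
      subst huy
      apply hzL
      rw [← Finset.mem_coe, coe_clF, hBdef, Finset.coe_pair]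
      exact hzxu
    · -- u ∈ E ∖ S, so z ∈ cl {x, u} ⊆ cl(E ∖ S) and ρ(E∖B) = ρ(E∖S)
      have huS : u ∈ gr M \ S := by
        rw [Finset.mem_sdiff, hSdef, Finset.mem_insert, Finset.mem_insert, Finset.mem_singleton, not_or, not_or]
        exact ⟨clF_subset_gr _ huL, huz, hux, huy⟩
      have hsub : ({x, u} : Set α) ⊆ M.closure ((gr M \ S : Finset α) : Set α) := by
        intro w hw
        rw [Set.mem_insert_iff, Set.mem_singleton_iff] at hw
        rcases hw with rfl | rfl
        · exact hxcl
        · exact M.subset_closure _ (by rw [Finset.coe_sdiff, coe_gr]; exact Set.sdiff_subset)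
            (by exact_mod_cast huS)
      have hzcl : z ∈ M.closure ((gr M \ S : Finset α) : Set α) :=
        M.closure_subset_closure_of_subset_closure hsub hzxu
      have hcomplB : gr M \ B = insert z (gr M \ S) := by
        ext w
        simp only [Finset.mem_sdiff, Finset.mem_insert, Finset.mem_singleton, hSdef, hBdef, not_or]
        constructor
        · rintro ⟨hw, hwx, hwy⟩
          by_cases hwz : w = z
          · exact Or.inl hwz
          · exact Or.inr ⟨hw, hwz, hwx, hwy⟩
        · rintro (rfl | ⟨hw, hwz, hwx, hwy⟩)
          · exact ⟨hzg, hxz.symm, hyz.symm⟩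
          · exact ⟨hw, hwx, hwy⟩
      have h1 : M.eRk ((gr M \ B : Finset α) : Set α) = M.eRk ((gr M \ S : Finset α) : Set α) := by
        rw [hcomplB, Finset.coe_insert, eRk_insert_eq_of_mem_closure_set hzcl]
      rw [eRk_gr_sdiff_eq_crk, eRk_gr_sdiff_eq_crk] at h1
      have : crk M B = crk M S := by exact_mod_cast h1
      omega

/-- **The bad-pair bound**: if `{x, y}` is a bad pair of the triangle `S = {x, y, z}`, the pair `{x, z}` pays at most
`3/4` (rank `4`). -/
theorem w4n_le_three_quarters_of_bad_pair (hR : M.eRank = (4 : ℕ∞)) (hsimple : ∀ T ⊆ M.E, T.encard ≤ 2 → M.Indep T)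
    {x y z : α} (hxy : x ≠ y) (hxz : x ≠ z) (hyz : y ≠ z) (hxg : x ∈ gr M) (hyg : y ∈ gr M) (hzg : z ∈ gr M)
    (hS : insert z ({x, y} : Finset α) ∈ Shadow.levelSet M 3) (hj : jB M {x, y} = 2)
    (hbad : crk M (insert z ({x, y} : Finset α)) + 1 = crk M {x, y}) :
    w4n M {x, z} (insert z ({x, y} : Finset α)) ≤ 3 / 4 := by
  obtain ⟨hcrk, hj0⟩ := crk_eq_and_jB_eq_zero_of_bad_pair hsimple hxy hxz hyz hxg hyg hzg hS hj hbad
  have hp4 : crk M {x, y} ≤ 4 := crk_le_of_eRank hR _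
  have hr3 : crk M (insert z ({x, y} : Finset α)) ≤ 3 := by omega
  by_cases hlt : crk M {x, z} < 3
  · rw [w4n_eq_zero_of_crk_lt_three hlt]; norm_num
  push Not at hlt
  have hsd : (insert z ({x, y} : Finset α) \ {x, z}).card = 1 := by
    have : insert z ({x, y} : Finset α) \ {x, z} = {y} := by
      ext w
      simp only [Finset.mem_sdiff, Finset.mem_insert, Finset.mem_singleton, not_or]
      constructor
      · rintro ⟨hw, hwx, hwz⟩
        rcases hw with rfl | rfl | rfl
        · exact absurd rfl hwz
        · exact absurd rfl hwx
        · rfl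
      · rintro rfl
        exact ⟨Or.inr (Or.inr rfl), hxy.symm, hyz⟩
    rw [this, Finset.card_singleton]
  unfold w4n
  rw [w4_of_sdiff_card_one_of_card_two hsd (Finset.card_pair hxz) hlt, if_pos hj0, hcrk]
  apply max_le (by norm_num)
  have hrq : (crk M (insert z ({x, y} : Finset α)) : ℚ) ≤ 3 := by exact_mod_cast hr3
  have hrpos : (0 : ℚ) < (crk M (insert z ({x, y} : Finset α)) : ℚ) + 1 := by positivity
  rw [div_le_iff₀ hrpos]
  linarith

/-- A pair of a rank-`3` set with one extra point pays at most `3/2`, and at most `1` unless it is bad. -/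
theorem w4n_le_of_pair_sdiff_one {B S : Finset α} (he : (S \ B).card = 1) (hB2 : B.card = 2) :
    w4n M B S ≤ 3 / 2 ∧ (¬ (jB M B = 2 ∧ crk M S + 1 = crk M B) → w4n M B S ≤ 1) := by
  by_cases hp3 : crk M B < 3
  · rw [w4n_eq_zero_of_crk_lt_three hp3]; constructor <;> intros <;> norm_num
  push Not at hp3
  have hpr : crk M B ≤ crk M S + 1 := by
    obtain ⟨y, hy⟩ := Finset.card_eq_one.1 he
    exact crk_le_crk_add_one_of_sdiff_singleton hy
  have hprq : (crk M B : ℚ) ≤ (crk M S : ℚ) + 1 := by exact_mod_cast hpr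
  have hrpos : (0 : ℚ) < (crk M S : ℚ) + 1 := by positivity
  unfold w4n
  rw [w4_of_sdiff_card_one_of_card_two he hB2 hp3]
  constructor
  · apply max_le (by norm_num)
    split_ifs
    · rw [div_le_iff₀ hrpos]; linarith
    · norm_num
    · norm_num
    · norm_num
  · intro hnot
    apply max_le (by norm_num)
    split_ifs with h0 h1 h2
    · rw [div_le_iff₀ hrpos]; linarith
    · norm_num
    · exfalso
      have hj2 : jB M B ≤ 2 := by unfold jB; exact min_le_left _ _
      exact hnot ⟨by omega, h2⟩
    · norm_num

/-- A pair `B' ≠ B` inside `insert z B` (`|B| = |B'| = 2`, `z ∉ B`) has the form `{x', z}` with `x' ∈ B`. -/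
theorem exists_eq_pair_of_subset_insert {B B' : Finset α} {z : α} (hzB : z ∉ B) (hB2 : B.card = 2)
    (hB'2 : B'.card = 2) (hB'S : B' ⊆ insert z B) (hne : B' ≠ B) : ∃ x' ∈ B, B' = {x', z} := by
  have hzB' : z ∈ B' := by
    by_contra hz
    apply hne
    apply Finset.eq_of_subset_of_card_le
    · intro w hw
      have := hB'S hw
      rw [Finset.mem_insert] at this
      rcases this with rfl | h
      · exact absurd hw hz
      · exact h
    · omega
  have hc : (B'.erase z).card = 1 := by rw [Finset.card_erase_of_mem hzB', hB'2]
  obtain ⟨x', hx'⟩ := Finset.card_eq_one.1 hc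
  have hx'B' : x' ∈ B'.erase z := by rw [hx']; exact Finset.mem_singleton_self _
  rw [Finset.mem_erase] at hx'B'
  refine ⟨x', ?_, ?_⟩
  · have := hB'S hx'B'.2
    rw [Finset.mem_insert] at this
    rcases this with h | h
    · exact absurd h hx'B'.1
    · exact h
  · rw [← Finset.insert_erase hzB', hx', Finset.pair_comm]

/-- **(Cap)(a)**: in a simple matroid of rank `4`, a rank-`3` set with three points pays at most `3`. -/
theorem cap_w4n_of_card_three (hR : M.eRank = (4 : ℕ∞)) (hsimple : ∀ T ⊆ M.E, T.encard ≤ 2 → M.Indep T)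
    {S : Finset α} (hS : S ∈ Shadow.levelSet M 3) (hSc : S.card = 3) :
    ∑ B ∈ (Profile.Rq M 2).filter (fun B => B ⊆ S), w4n M B S ≤ 3 := by
  classical
  set Φ := (Profile.Rq M 2).filter (fun B => B ⊆ S) with hΦ
  have hSg : S ⊆ gr M := (Profile.mem_levelSet.1 hS).1
  -- every member of Φ is a pair with one extra point
  have hpair : ∀ B ∈ Φ, B.card = 2 ∧ (S \ B).card = 1 := by
    intro B hB
    have hBS : B ⊆ S := (Finset.mem_filter.1 hB).2
    have h2 := two_le_card_of_mem_Rq_two (Finset.mem_filter.1 hB).1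
    have hne := ne_of_mem_filter_levelSet hS hB
    have hle := Finset.card_le_card hBS
    have hc : (S \ B).card = S.card - B.card := Finset.card_sdiff_of_subset hBS
    have hB3 : B.card ≠ 3 := by
      intro h3
      exact hne (Finset.eq_of_subset_of_card_le hBS (by omega))
    omega
  have hΦsub : Φ ⊆ S.powersetCard 2 := by
    intro B hB
    rw [Finset.mem_powersetCard]
    exact ⟨(Finset.mem_filter.1 hB).2, (hpair B hB).1⟩
  have hΦcard : Φ.card ≤ 3 := by
    calc Φ.card ≤ (S.powersetCard 2).card := Finset.card_le_card hΦsub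
      _ = Nat.choose 3 2 := by rw [Finset.card_powersetCard, hSc]
      _ = 3 := by decide
  by_cases hbad : ∃ B ∈ Φ, jB M B = 2 ∧ crk M S + 1 = crk M B
  · obtain ⟨B, hBΦ, hjB, hcB⟩ := hbad
    have hB2 := (hpair B hBΦ).1
    obtain ⟨z, hz⟩ := Finset.card_eq_one.1 (hpair B hBΦ).2
    have hBS : B ⊆ S := (Finset.mem_filter.1 hBΦ).2
    have hzS : z ∈ S := by
      have : z ∈ S \ B := by rw [hz]; exact Finset.mem_singleton_self z
      exact (Finset.mem_sdiff.1 this).1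
    have hzB : z ∉ B := by
      have : z ∈ S \ B := by rw [hz]; exact Finset.mem_singleton_self z
      exact (Finset.mem_sdiff.1 this).2
    have hSeq : S = insert z B := by
      ext w
      rw [Finset.mem_insert]
      constructor
      · intro hw
        by_cases hwB : w ∈ B
        · exact Or.inr hwB
        · left
          have : w ∈ S \ B := Finset.mem_sdiff.2 ⟨hw, hwB⟩
          rw [hz] at this
          exact Finset.mem_singleton.1 this
      · rintro (rfl | hw)
        · exact hzS
        · exact hBS hw
    obtain ⟨x, y, hxy, hBxy⟩ := Finset.card_eq_two.1 hB2
    have hxg : x ∈ gr M := hSg (hBS (by rw [hBxy]; exact Finset.mem_insert_self _ _))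
    have hyg : y ∈ gr M := hSg (hBS (by rw [hBxy]; exact Finset.mem_insert_of_mem (Finset.mem_singleton_self _)))
    have hzg : z ∈ gr M := hSg hzS
    have hxz : x ≠ z := by rintro rfl; exact hzB (by rw [hBxy]; exact Finset.mem_insert_self _ _)
    have hyz : y ≠ z := by
      rintro rfl; exact hzB (by rw [hBxy]; exact Finset.mem_insert_of_mem (Finset.mem_singleton_self _))
    -- the other pairs pay at most 3/4
    have hother : ∀ B' ∈ Φ.erase B, w4n M B' S ≤ 3 / 4 := by
      intro B' hB'
      rw [Finset.mem_erase] at hB'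
      obtain ⟨x', hx'B, hB'eq⟩ := exists_eq_pair_of_subset_insert hzB hB2 (hpair B' hB'.2).1
        (by rw [← hSeq]; exact (Finset.mem_filter.1 hB'.2).2) hB'.1
      rw [hBxy, Finset.mem_insert, Finset.mem_singleton] at hx'B
      rcases hx'B with rfl | rfl
      · rw [hB'eq, hSeq, hBxy]
        rw [hSeq, hBxy] at hS hcB
        rw [hBxy] at hjB
        exact w4n_le_three_quarters_of_bad_pair hR hsimple hxy hxz hyz hxg hyg hzg hS hjB hcB
      · rw [hB'eq, hSeq, hBxy, Finset.pair_comm x x']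
        rw [hSeq, hBxy, Finset.pair_comm x x'] at hS hcB
        rw [hBxy, Finset.pair_comm x x'] at hjB
        exact w4n_le_three_quarters_of_bad_pair hR hsimple hxy.symm hyz hxz hyg hxg hzg hS hjB hcB
    have hB32 : w4n M B S ≤ 3 / 2 := (w4n_le_of_pair_sdiff_one (hpair B hBΦ).2 hB2).1
    have hcard' : (Φ.erase B).card ≤ 2 := by
      rw [Finset.card_erase_of_mem hBΦ]; omega
    calc ∑ B' ∈ Φ, w4n M B' S = w4n M B S + ∑ B' ∈ Φ.erase B, w4n M B' S := (Finset.add_sum_erase Φ _ hBΦ).symm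
      _ ≤ 3 / 2 + ∑ _B' ∈ Φ.erase B, (3 / 4 : ℚ) := add_le_add hB32 (Finset.sum_le_sum hother)
      _ = 3 / 2 + ((Φ.erase B).card : ℚ) * (3 / 4) := by rw [Finset.sum_const, nsmul_eq_mul]
      _ ≤ 3 / 2 + 2 * (3 / 4) := by
          have : ((Φ.erase B).card : ℚ) ≤ 2 := by exact_mod_cast hcard'
          linarith
      _ = 3 := by norm_num
  · push Not at hbad
    have hle : ∀ B ∈ Φ, w4n M B S ≤ 1 := by
      intro B hB
      exact (w4n_le_of_pair_sdiff_one (hpair B hB).2 (hpair B hB).1).2 (fun h => hbad B hB h.1 h.2)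
    calc ∑ B ∈ Φ, w4n M B S ≤ ∑ _B ∈ Φ, (1 : ℚ) := Finset.sum_le_sum hle
      _ = (Φ.card : ℚ) := by rw [Finset.sum_const, nsmul_eq_mul, mul_one]
      _ ≤ 3 := by exact_mod_cast hΦcard

end CapA

end PercRepro
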